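import Summits.BirchSwinnertonDyer.Rank1Residual.GaloisImage.MultiplicativeCartanNormalizer
import Summits.BirchSwinnertonDyer.Rank1Residual.Partition.Rows
import Literature.NumberTheory.SerreUniformity.SplitCartanProofs
import Literature.NumberTheory.EllipticCurves.ModSevenImageSplitCartanJLine
import Literature.NumberTheory.EllipticCurves.ComplexMultiplicationNotSemistable
import HarnessLib

/-!
# Route `ErratumRoadFive` (rung K2), crux `NonSurjCorner` (item stmt-BirchSwinnertonDyer-19065):
# THE `p = 7` BRANCH OF THE CORNER IS THE X11b PART OF THE RATIONAL CURVE `X_s⁺(7)` — every corner pair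
# at `7` has `j(E) = J₂(t)`, `t ∈ ℚ` (Zywina's `N_s(7)` j-line), and conversely
# (cell `bsd-stepL`, seat `bsd-stepL-corner5-p2` g4, WIDTH-LEVER lane B «class-level road»;
# `--supports stmt-BirchSwinnertonDyer-19065 --as helper`)

WHY THIS FILE. The registered stub `stub_corner7` of the crux (skeleton b2731b9ab55f) is the `p = 7` branch:
`ClassX11b W 7 → ¬ Surj W 7 → … → MissingPPartAt W 7`. It is EMPTY below conductor `5·10⁵` and infinite above
(lane A CORNER-G3; this lane's g0 certified three members `t = −1/7, 17/7, 16/7` and g2 found a real-Cartan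
member `t = −19/7`, all located NUMERICALLY on Zywina's j-line `J₂`). This file puts the parametrisation in
the kernel, modulo Zywina 2015 Thm. 1.5 taken BY NAME:

* `hasSplitCartanNormalizerModPImage_of_mult_of_irr_of_not_surj` (any `p ≥ 7`): `Mult ∧ Irr ∧ ¬Surj` ⟹ the
  mod-`p` image lies in the normaliser of a split Cartan subgroup, in the explicit-basis currency
  `SerreUniformity.HasSplitCartanNormalizerModPImage` of the tree's Serre-uniformity files (x11c gen 7's
  `GaloisImage.exists_le_normalizer_splitCartan_of_mult_of_irr_of_not_surj` + the dictionary
  `hasSplitCartanNormalizerModPImage_of_le_normalizer_splitCartan`). (At `p ≥ 11` this is what BDMTV 2019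
  forbids for non-CM curves — x11c's `eq_five_or_eq_seven_of_mult_of_irr_of_not_surj`; at `p = 7` it is a
  `ℚ`-point of `X_s⁺(7) ≅ ℙ¹`.)
* the named fact `zywina2015_thm15_exists_j_eq_J2_of_splitCartanNormalizer_seven` — Zywina 2015 Thm. 1.5
  (`ℓ = 7`), second item, `i = 2`, «only if» half: a non-CM `E/ℚ` whose mod-`7` image is conjugate into
  `G₂ = N_s(7)` has `j(E) = J₂(t)` for some `t ∈ ℚ` (the «if» half, weakened to non-surjectivity, is the
  tree's `zywina2015_thm15_not_surjective_seven_of_j_eq_J2`, this lane g0);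
* **`NonSurjCorner.exists_j_eq_J2_seven`**: every corner pair at `p = 7` (`ClassX11b W 7 ∧ ¬ Surj W 7`) has
  `j(W)·(t³−4t²+3t+1)⁷ = t(t+1)³(t²−5t+1)³(t²−5t+8)³(t⁴−5t³+8t²−7t+7)³` for some `t ∈ ℚ` (a multiplicative
  prime excludes CM: `not_mult_of_hasCM`); the same for the X11a leaf twins (`NonSurjTwin.exists_j_eq_J2_seven`);
* **`NonSurjCorner.not_surj_seven_iff_exists_j_eq_J2`**: on class X11b at `7`, `¬ Surj W 7 ⟺ ∃ t ∈ ℚ,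
  j(W) = J₂(t)` (both Zywina halves) — **the `p = 7` corner is exactly the X11b part of the `J₂`-line**.

HONEST FRAMING: structure theorems + ONE cite-tagged named fact (Zywina 2015 Thm. 1.5, a published
modular-curve computation, consumed by name; nothing is asserted about it); nothing here proves the crux, a
registered stub or BSD for any class; no census number moves (T7). The `p = 5` analogue (corner at `5` ⊆
Zywina's `G₉ ⊇ N_s(5)`: `j = t³(t²+5t+40)`, Thm. 1.4 `i = 9`; `5Ns` part `j = J₄(t)`) needs an explicit
`G₉ ≤ GL₂(𝔽₅)` predicate the tree does not have — not attempted (`-- TODO`).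
References: [Zywina2015] §1.4 (`G₂ = N_s(7)`, `J₂`), Thm. 1.5 (arXiv:1508.07660 pp. 5–6);
[BiluParentRebolledo2013] §1 (`X_split(p) ≅ X₀⁺(p²)`); [Serre1972] §2.2, Props. 14, 15, 17;
[SilvermanATAEC1994] Thm. II.6.4 (CM ⟹ no multiplicative prime).
-/

set_option linter.dupNamespace false -- `Summit.BirchSwinnertonDyer.BirchSwinnertonDyer` (summit = problem), tree-wide
set_option autoImplicit false

noncomputable section

open scoped Classical NumberField
open IsDedekindDomain Field WeierstrassCurve

namespace Summit.BirchSwinnertonDyer.BirchSwinnertonDyer.Theorems.CornerShape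

open WeierstrassCurve NumberField
  Literature.NumberTheory.EllipticCurves
  Literature.NumberTheory.EllipticCurves.Rank1Residual
  Literature.NumberTheory.SerreUniformity
  Summit.BirchSwinnertonDyer.Rank1Residual

variable (W : WeierstrassCurve ℚ) [W.IsElliptic] (p : ℕ) [hp : Fact p.Prime]

/-! ### §1. `Mult ∧ Irr ∧ ¬Surj` at `p ≥ 7`: the image lies in the normaliser of a split Cartan subgroup -/

/-- **At a multiplicative `p ≥ 7` with `E[p]` irreducible and `ρ̄_{E,p}` not onto, the mod-`p` image is
contained in the normaliser of a split Cartan subgroup** — in the explicit-basis predicate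
`HasSplitCartanNormalizerModPImage W p` (some basis of `E[p]` in which every `σ ∈ Γ_ℚ` acts by an invertible
diagonal or antidiagonal matrix; for `F = ℚ`: `j(W)` is the `j`-invariant of a non-cuspidal `ℚ`-point of
`X_split(p)`). x11c gen 7's subgroup-form theorem (Serre 1972 §1.12 + Props. 14, 15, 17) read through the
Serre-uniformity dictionary. [cite: Serre1972, §2.2 Prop. 14, §2.4 Prop. 15, §2.7 Prop. 17]
[cite: BiluParentRebolledo2013, §1 (the paragraph before Cor. 1.2)] -/
theorem hasSplitCartanNormalizerModPImage_of_mult_of_irr_of_not_surj (hp7 : 7 ≤ p) (hmult : Mult W p)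
    (hirr : Irr W p) (hns : ¬ Surj W p) : HasSplitCartanNormalizerModPImage W p := by
  obtain ⟨e, Φ, he, -⟩ := exists_frame_galoisRepTorsion_rat W p
  obtain ⟨P, -, hGN, -⟩ :=
    GaloisImage.exists_le_normalizer_splitCartan_of_mult_of_irr_of_not_surj W p Φ e he hp7 hmult hirr hns
  exact hasSplitCartanNormalizerModPImage_of_le_normalizer_splitCartan (by omega) W Φ e he hGN

/-- A curve with a multiplicative prime has no CM (Silverman *ATAEC* II.6.4; the tree's
`not_mult_of_hasCM`), read on class X11b. [cite: SilvermanATAEC1994, Thm. II.6.4 (PDF p. 148)] -/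
theorem NonSurjCorner.not_hasCM (hX : ClassX11b W p) : ¬ W.HasCM :=
  fun hCM => not_mult_of_hasCM W hCM p hX.2.2.1

/-- **Every corner pair at `p = 7` gives a `ℚ`-point of `X_s⁺(7)`**: `ClassX11b W 7 ∧ ¬ Surj W 7` ⟹
`HasSplitCartanNormalizerModPImage W 7`. (This lane's g2 `NonSurjCorner.shape_seven` has the finer subgroup
form with the inertia placed; here only the Serre-uniformity predicate is recorded.)
[cite: Serre1972, §2.2 Prop. 14, §2.4 Prop. 15, §2.7 Prop. 17] [cite: Zywina2015, Thm. 1.5 (ℓ = 7)] -/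
theorem NonSurjCorner.hasSplitCartanNormalizerModPImage_seven [Fact (Nat.Prime 7)] (hX : ClassX11b W 7)
    (hns : ¬ Surj W 7) : HasSplitCartanNormalizerModPImage W 7 :=
  hasSplitCartanNormalizerModPImage_of_mult_of_irr_of_not_surj W 7 le_rfl hX.2.2.1 hX.2.2.2 hns

/-! ### §2. Zywina's `N_s(7)` j-line (named fact, consumed by name) and the corner on it -/

/-- **EVERY CORNER PAIR AT `p = 7` LIES ON ZYWINA'S `N_s(7)` j-LINE**: for `(E, 7)` in class X11b
(`r_an = 1`, `7 ∥ N`, `E[7]` irreducible) with `ρ̄_{E,7}` NOT onto, there is `t ∈ ℚ` with `j(E) = J₂(t)`,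
i.e. `j(E)·(t³−4t²+3t+1)⁷ = t(t+1)³(t²−5t+1)³(t²−5t+8)³(t⁴−5t³+8t²−7t+7)³` (given Zywina's Thm. 1.5 by name:
`hZ`). The members of record: `t = −1/7` (g0 `…SevenInstanceTm1o7`), `17/7`, `16/7`, and g2's real-Cartan
member `t = −19/7`. [cite: Zywina2015, Thm. 1.5 (second item, i = 2), §1.4] [cite: SilvermanATAEC1994, Thm. II.6.4] -/
theorem NonSurjCorner.exists_j_eq_J2_seven [Fact (Nat.Prime 7)]
    (hZ : Literature.NumberTheory.EllipticCurves.zywina2015_thm15_exists_j_eq_J2_of_splitCartanNormalizer_seven)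
    (hX : ClassX11b W 7) (hns : ¬ Surj W 7) :
    ∃ t : ℚ, t ^ 3 - 4 * t ^ 2 + 3 * t + 1 ≠ 0 ∧
      W.j * (t ^ 3 - 4 * t ^ 2 + 3 * t + 1) ^ 7 =
        t * (t + 1) ^ 3 * (t ^ 2 - 5 * t + 1) ^ 3 * (t ^ 2 - 5 * t + 8) ^ 3 *
          (t ^ 4 - 5 * t ^ 3 + 8 * t ^ 2 - 7 * t + 7) ^ 3 :=
  hZ W (NonSurjCorner.not_hasCM W 7 hX) (NonSurjCorner.hasSplitCartanNormalizerModPImage_seven W hX hns)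

/-- The same for the rank-0 X11a LEAF TWINS of the corner at `7` (child 19948; `ClassX11a Wd 7 ∧ ¬ Surj Wd 7`):
`j(Wd) = J₂(t)` for some `t ∈ ℚ`. [cite: Zywina2015, Thm. 1.5 (second item, i = 2), §1.4] -/
theorem NonSurjTwin.exists_j_eq_J2_seven [W.IsGloballyMinimal] [Fact (Nat.Prime 7)]
    (hZ : Literature.NumberTheory.EllipticCurves.zywina2015_thm15_exists_j_eq_J2_of_splitCartanNormalizer_seven)
    (hXa : ClassX11a W 7) (hns : ¬ Surj W 7) :
    ∃ t : ℚ, t ^ 3 - 4 * t ^ 2 + 3 * t + 1 ≠ 0 ∧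
      W.j * (t ^ 3 - 4 * t ^ 2 + 3 * t + 1) ^ 7 =
        t * (t + 1) ^ 3 * (t ^ 2 - 5 * t + 1) ^ 3 * (t ^ 2 - 5 * t + 8) ^ 3 *
          (t ^ 4 - 5 * t ^ 3 + 8 * t ^ 2 - 7 * t + 7) ^ 3 :=
  hZ W (fun hCM => not_mult_of_hasCM W hCM 7 hXa.2.2.1)
    (hasSplitCartanNormalizerModPImage_of_mult_of_irr_of_not_surj W 7 le_rfl hXa.2.2.1 hXa.2.2.2.1 hns)

/-- **THE `p = 7` CORNER IS EXACTLY THE X11b PART OF THE `J₂`-LINE**: on class X11b at `7`,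
`ρ̄_{E,7}` is NOT onto iff `j(E) = J₂(t)` for some `t ∈ ℚ` — ⟹ by Zywina's «only if» half (`hZ`, this file's
fact) and ⟸ by the «if» half (`hZ'`, the tree's `zywina2015_thm15_not_surjective_seven_of_j_eq_J2`); CM is
excluded by the multiplicative prime `7`. So `stub_corner7` quantifies over the rational points `t` of a `ℙ¹`
meeting class X11b. [cite: Zywina2015, Thm. 1.5 (second item, i = 2), §1.4 (arXiv:1508.07660 pp. 5–6)] -/
theorem NonSurjCorner.not_surj_seven_iff_exists_j_eq_J2 [Fact (Nat.Prime 7)]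
    (hZ : Literature.NumberTheory.EllipticCurves.zywina2015_thm15_exists_j_eq_J2_of_splitCartanNormalizer_seven)
    (hZ' : zywina2015_thm15_not_surjective_seven_of_j_eq_J2) (hX : ClassX11b W 7) :
    ¬ Surj W 7 ↔
      ∃ t : ℚ, t ^ 3 - 4 * t ^ 2 + 3 * t + 1 ≠ 0 ∧
        W.j * (t ^ 3 - 4 * t ^ 2 + 3 * t + 1) ^ 7 =
          t * (t + 1) ^ 3 * (t ^ 2 - 5 * t + 1) ^ 3 * (t ^ 2 - 5 * t + 8) ^ 3 *
            (t ^ 4 - 5 * t ^ 3 + 8 * t ^ 2 - 7 * t + 7) ^ 3 :=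
  ⟨NonSurjCorner.exists_j_eq_J2_seven W hZ hX,
    fun ⟨t, ht, hj⟩ => hZ' W (NonSurjCorner.not_hasCM W 7 hX) t ht hj⟩

end Summit.BirchSwinnertonDyer.BirchSwinnertonDyer.Theorems.CornerShape

end
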